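import Summits.BirchSwinnertonDyer.BirchSwinnertonDyer.Theorems.ShaPrimaryTransferFiniteShaComponentTransferSelmerCubicKillCertModSig2C
import Summits.BirchSwinnertonDyer.BirchSwinnertonDyer.Theorems.ShaPrimaryTransferFiniteShaComponentTransferSelmerCubicKillCertModSig8
import Summits.BirchSwinnertonDyer.BirchSwinnertonDyer.Theorems.ShaPrimaryTransferFiniteShaComponentTransferSelmerCubicKillCertModSig2X
import Summits.BirchSwinnertonDyer.BirchSwinnertonDyer.Theorems.ShaPrimaryTransferFiniteShaComponentTransferSelmerCubicKillCertModSig12R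
import HarnessLib

/-!
# BirchSwinnertonDyer — SEL2CUBIC kill layer: every landed certificate shape yields a RESIDUE certificate

HONEST FRAMING: route `ShaPrimaryTransfer`, seat `bsd-line-spt-p1` (g30), `--supports` item T =
`FiniteShaComponentTransfer` (stmt-22356), UNCHANGED (conjecture-grade at corank ≥ 2). BSD in rank ≥ 2 is NOT
proved by any of this. THEOREMS ONLY.

The per-kill hypothesis of the Selmer-sound sieves (`admKillsV_sound_sel`, and the kill-row doors built on it) is
the RESIDUE certificate of a class `z` at a prime `p`:
«`∃ N, ∀ v ∈ ℤ⁴` not divisible by `p`, `p^N ∤ (Q₁(v), Q₂(v))`» for the kill quadrics `killQ a b c z t₁ t₂`.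
This file packages the residue-form soundness theorems of the seven certificate shapes of the census
(`…KillCertMod{,Sig2C,Sig8,Sig2X,Sig12U,Sig12R}`) in exactly that shape, so that a census row's kill term
`killValidAt_of_<shape> … (by decide +kernel)` becomes `killResidue_of_<shape> … (by decide +kernel)` with the
SAME kernel certificate: `killCheck` (residue trees, `N = fuel + 1`), `sig3Check`, `sig12uCheck`, `sig12rCheck`
(odd `q`), `sig2cCheck`, `sig8Check`, `sig2xCheck` (`p = 2`). [cite: CremonaAlgorithms1997, §3.6]
-/

-- single-conjunct summit: `Summit.BirchSwinnertonDyer.BirchSwinnertonDyer.…` repeats the name by design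
set_option linter.dupNamespace false

namespace Summit.BirchSwinnertonDyer.BirchSwinnertonDyer.Theorems.ShaPrimaryTransferSelmerCubicKill

open Summit.BirchSwinnertonDyer.BirchSwinnertonDyer.Rank2Observatory
open Summit.BirchSwinnertonDyer.BirchSwinnertonDyer.Rank2Observatory.TwoDescKill

/-- Residue certificate from the landed residue tree `killCheck` (`N = fuel + 1`). [cite: CremonaAlgorithms1997, §3.6] -/
theorem killResidue_of_killCheck {p : ℕ} (hp : p.Prime) {a b c : ℤ} {z : ℤ × ℤ × ℤ} {t₁ t₂ : ℤ} {fuel : ℕ}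
    (h : killCheck p a b c z t₁ t₂ fuel = true) :
    ∃ N : ℕ, ∀ v : ℤ × ℤ × ℤ × ℤ, ¬ ((p : ℤ) ∣ v.1 ∧ (p : ℤ) ∣ v.2.1 ∧ (p : ℤ) ∣ v.2.2.1 ∧ (p : ℤ) ∣ v.2.2.2) →
      (p : ℤ) ^ N ∣ (killQ a b c z t₁ t₂ v).1 → (p : ℤ) ^ N ∣ (killQ a b c z t₁ t₂ v).2 → False :=
  ⟨fuel + 1, fun v hprim h1 h2 => killCheck_sound_mod hp h v hprim ⟨h1, h2⟩⟩

/-- Residue certificate from the TIER-1 signature certificate `sig3Check` at an odd prime `q`.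
[cite: CremonaAlgorithms1997, §3.6] -/
theorem killResidue_of_sig3Check {q : ℕ} (hq : q.Prime) {a b c : ℤ} {z : ℤ × ℤ × ℤ} {t₁ t₂ : ℤ} {N : ℕ}
    {ε₁ ε₂ ε₃ : ℤ} (h : sig3Check q a b c z t₁ t₂ N ε₁ ε₂ ε₃ = true) :
    ∃ N : ℕ, ∀ v : ℤ × ℤ × ℤ × ℤ, ¬ ((q : ℤ) ∣ v.1 ∧ (q : ℤ) ∣ v.2.1 ∧ (q : ℤ) ∣ v.2.2.1 ∧ (q : ℤ) ∣ v.2.2.2) →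
      (q : ℤ) ^ N ∣ (killQ a b c z t₁ t₂ v).1 → (q : ℤ) ^ N ∣ (killQ a b c z t₁ t₂ v).2 → False :=
  ⟨N, fun v hprim h1 h2 => sig3Check_sound_mod hq h v hprim ⟨h1, h2⟩⟩

/-- Residue certificate from the TIER-2u certificate `sig12uCheck` at an odd prime `q`.
[cite: CremonaAlgorithms1997, §3.6] -/
theorem killResidue_of_sig12uCheck {q : ℕ} (hq : q.Prime) {a b c : ℤ} {z : ℤ × ℤ × ℤ} {t₁ t₂ : ℤ} {N : ℕ}
    {ε : ℤ} (h : sig12uCheck q a b c z t₁ t₂ N ε = true) :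
    ∃ N : ℕ, ∀ v : ℤ × ℤ × ℤ × ℤ, ¬ ((q : ℤ) ∣ v.1 ∧ (q : ℤ) ∣ v.2.1 ∧ (q : ℤ) ∣ v.2.2.1 ∧ (q : ℤ) ∣ v.2.2.2) →
      (q : ℤ) ^ N ∣ (killQ a b c z t₁ t₂ v).1 → (q : ℤ) ^ N ∣ (killQ a b c z t₁ t₂ v).2 → False :=
  ⟨N, fun v hprim h1 h2 => sig12uCheck_sound_mod hq h v hprim ⟨h1, h2⟩⟩

/-- Residue certificate from the TIER-2r certificate `sig12rCheck` at an odd prime `q`.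
[cite: CremonaAlgorithms1997, §3.6] -/
theorem killResidue_of_sig12rCheck {q : ℕ} (hq : q.Prime) {a b c : ℤ} {z : ℤ × ℤ × ℤ} {t₁ t₂ : ℤ} {N : ℕ}
    {ε : ℤ} (h : sig12rCheck q a b c z t₁ t₂ N ε = true) :
    ∃ N : ℕ, ∀ v : ℤ × ℤ × ℤ × ℤ, ¬ ((q : ℤ) ∣ v.1 ∧ (q : ℤ) ∣ v.2.1 ∧ (q : ℤ) ∣ v.2.2.1 ∧ (q : ℤ) ∣ v.2.2.2) →
      (q : ℤ) ^ N ∣ (killQ a b c z t₁ t₂ v).1 → (q : ℤ) ^ N ∣ (killQ a b c z t₁ t₂ v).2 → False :=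
  ⟨N, fun v hprim h1 h2 => sig12rCheck_sound_mod hq h v hprim ⟨h1, h2⟩⟩

/-- Residue certificate at `p = 2` from the cubic-place certificate `sig2cCheck`. [cite: CremonaAlgorithms1997, §3.6] -/
theorem killResidue_of_sig2cCheck {ram : Bool} {a b c : ℤ} {z : ℤ × ℤ × ℤ} {t₁ t₂ : ℤ} {N : ℕ} {ρ : ℤ × ℤ × ℤ}
    {jmax : ℕ} (h : sig2cCheck ram a b c z t₁ t₂ N ρ jmax = true) :
    ∃ N : ℕ, ∀ v : ℤ × ℤ × ℤ × ℤ,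
      ¬ (((2 : ℕ) : ℤ) ∣ v.1 ∧ ((2 : ℕ) : ℤ) ∣ v.2.1 ∧ ((2 : ℕ) : ℤ) ∣ v.2.2.1 ∧
          ((2 : ℕ) : ℤ) ∣ v.2.2.2) →
      ((2 : ℕ) : ℤ) ^ N ∣ (killQ a b c z t₁ t₂ v).1 → ((2 : ℕ) : ℤ) ^ N ∣ (killQ a b c z t₁ t₂ v).2 →
      False :=
  ⟨N, fun v hprim h1 h2 => sig2cCheck_sound_mod h v (by exact_mod_cast hprim)
    ⟨by exact_mod_cast h1, by exact_mod_cast h2⟩⟩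

/-- Residue certificate at `p = 2` from the three-root certificate `sig8Check`. [cite: CremonaAlgorithms1997, §3.6] -/
theorem killResidue_of_sig8Check {a b c : ℤ} {z : ℤ × ℤ × ℤ} {t₁ t₂ : ℤ} {N : ℕ} {ε₁ ε₂ ε₃ : ℤ}
    (h : sig8Check a b c z t₁ t₂ N ε₁ ε₂ ε₃ = true) :
    ∃ N : ℕ, ∀ v : ℤ × ℤ × ℤ × ℤ,
      ¬ (((2 : ℕ) : ℤ) ∣ v.1 ∧ ((2 : ℕ) : ℤ) ∣ v.2.1 ∧ ((2 : ℕ) : ℤ) ∣ v.2.2.1 ∧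
          ((2 : ℕ) : ℤ) ∣ v.2.2.2) →
      ((2 : ℕ) : ℤ) ^ N ∣ (killQ a b c z t₁ t₂ v).1 → ((2 : ℕ) : ℤ) ^ N ∣ (killQ a b c z t₁ t₂ v).2 →
      False :=
  ⟨N, fun v hprim h1 h2 => sig8Check_sound_mod h v (by exact_mod_cast hprim)
    ⟨by exact_mod_cast h1, by exact_mod_cast h2⟩⟩

/-- Residue certificate at `p = 2` from the one-root-and-a-quadratic-place certificate `sig2xCheck`.
[cite: CremonaAlgorithms1997, §3.6] -/
theorem killResidue_of_sig2xCheck {a b c : ℤ} {z : ℤ × ℤ × ℤ} {t₁ t₂ : ℤ} {N : ℕ} {ε s₁ s₀ p q : ℤ}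
    (h : sig2xCheck a b c z t₁ t₂ N ε s₁ s₀ p q = true) :
    ∃ N : ℕ, ∀ v : ℤ × ℤ × ℤ × ℤ,
      ¬ (((2 : ℕ) : ℤ) ∣ v.1 ∧ ((2 : ℕ) : ℤ) ∣ v.2.1 ∧ ((2 : ℕ) : ℤ) ∣ v.2.2.1 ∧
          ((2 : ℕ) : ℤ) ∣ v.2.2.2) →
      ((2 : ℕ) : ℤ) ^ N ∣ (killQ a b c z t₁ t₂ v).1 → ((2 : ℕ) : ℤ) ^ N ∣ (killQ a b c z t₁ t₂ v).2 →
      False :=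
  ⟨N, fun v hprim h1 h2 => sig2xCheck_sound_mod h v (by exact_mod_cast hprim)
    ⟨by exact_mod_cast h1, by exact_mod_cast h2⟩⟩

end Summit.BirchSwinnertonDyer.BirchSwinnertonDyer.Theorems.ShaPrimaryTransferSelmerCubicKill
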